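import Literature.AlgebraicGeometry.Resolution.IntegralClosureEssFiniteType
import Literature.AlgebraicGeometry.Resolution.LocalBlowup
import Summits.ResolutionOfSingularities.ResolutionOfSingularities.Theorems.RadicialJungCleanModelsCcurveUnitCase
import Summits.ResolutionOfSingularities.ResolutionOfSingularities.Theorems.RadicialJungCleanModelsCcurveQuotientDVR
import Summits.ResolutionOfSingularities.ResolutionOfSingularities.Theorems.RadicialJungCleanModelsCcurvePersistForm2Alg
import HarnessLib

/-!
# Lens 5 (transfer from the solved sibling) — the UNIT CASE of the (C-curve) closed-point persist over an ARBITRARY ground field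

Crux workfile on `stmt-ResolutionOfSingularities-0549` (`Theses.Descent.DescentPerfectToAll`), seat `res-B-lens-5` g16, serving the lead's
(`res-B-lead-1`) registered skeleton `Cruxes/CleanModels/Lines/Sketch.lean` (stmt-15917 `RadicialJung.CleanModels`), sub-line (C-curve).
OURS · counted 0.  Nothing here proves resolution in characteristic `p`; resolution in char `p` is NOT proved.

## What this file is for

The lead's (C-curve) slice of the research stub `stub_cleanLU3DefectNonDiscrete` is kernel-closed over a PERFECT ground field `k`
(`Ccurve.cleanLU3Defect_of_properCoarsening_perfect`, memo `Cruxes/CleanModels/Lines/Sketch-memo-Ccurve-closed.md`), and perfectness enters ONLY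
through the unit case `Ccurve.persistForm2_of`, whose algebraic step is ✓ `Ccurve.exists_sub_pow_eq_of_form2`: at the regular 3-dimensional local
ring `S` of the closed centre with r.s.p. `(x, y, z)`, a representative `w` of the `K^p`-line which is a unit modulo `P = (x, y)` with residue not a
`p`-th power in `κ(C) = Frac(S/P)` satisfies `w − c^p = U z^i + x α + y β` with `U` a unit and `p ∤ i`.  Over perfect `k` this uses
`[κ(C) : κ(C)^p] = p` (the `p`-basis `z̄`); over an imperfect `k` that count is `p^{r+1}` and the conclusion `p ∤ i` is FALSE in general
(example: `k = 𝔽_p(s)`, `w = s + z^p`: for EVERY `c` the residue `s − c̄^p` of `w − c^p` is non-zero, so `v(w − c^p) = 0`, `i = 0`, and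
`w − c^p` is a unit whose residue is not a `p`-th power — no `c` gives an order prime to `p`).

THIS FILE proves the field-independent replacement — the **best `p`-th-power approximation DICHOTOMY in a Japanese discrete valuation ring**
(lens 5's class (A) engine «excellent ⇒ defectless ⇒ best approximation», transplanted from the arc valuation to the DVR `O_{C,P} = S/P` of the
centre curve):

* §A `unitCase_core_dichotomy` — in a DVR `D` of characteristic `p` with uniformizer `z`: if `v(w − c^p)` is bounded over `c ∈ D`, then at a
  maximising `c`, `w − c^p = u · z^i` with `u` a unit and **`p ∤ i` OR `u` is not a `p`-th power modulo `𝔪_D`** (the lead's `unitCase_core`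
  without the perfectness hypothesis: when both fail one improves `c ↦ c + e z^{i/p}`).
* §B `unitCase_bound_of_moduleFinite` — BOUNDEDNESS from N-2: if `w ≠ a^p` for all `a ∈ D`, `θ^p = w` in a field `L ⊇ Frac D`, and the integral closure `R′` of `D` in `L` is a finite `D`-module, then `v(w − c^p) ≤ M` for all `c`.  Proof: `Q := R′/D·1` is
  finitely generated and torsion-free (`D` integrally closed), hence free over the PID `D`; the class of `θ` in `Q` is non-zero (`w` is not a `p`-th
  power), so it has a finite `z`-adic order `n₀` in the free module `Q`; if `z^{p n₀} ∣ w − c^p` then `ξ := (θ − c)/z^{n₀}` has `ξ^p ∈ D`, is integral,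
  lies in `R′`, and `θ ≡ z^{n₀} ξ (mod D·1)` — contradiction.  (No excellence / completion is used: only «integral closure finite».)
* §C `moduleFinite_integralClosure_of_essFiniteType` — N-2 for domains essentially of finite type over a field, in a finite extension of the
  fraction field: E. Noether (tree ✓ `NoetherFiniteIntegralClosure_holds`, Liu 2002 Prop. 4.1.27) + localisation (tree ✓
  `module_finite_integralClosure_of_isLocalization`, Stacks 0307).
* §D `exists_sub_pow_eq_unit_mul_pow_general` — §A + §B + §C with `L := Frac(D)[X]/(X^p − w)` (a field by ✓ `X_pow_sub_C_irreducible_of_prime`):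
  for `D` a DVR of characteristic `p` essentially of finite type over a field and `w` not a `p`-th power in `Frac D`,
  `∃ c i u, w − c^p = u z^i ∧ (p ∤ i ∨ ∀ e, u − e^p ∉ 𝔪_D)`.
* §D′ `unitCase_bound_general`, §H `exists_best_pthPowerApprox` — the bound / a best `p`-th-power approximation `c₀ ∈ D` alone (no `IsDefectlessField`
  hypothesis; bridge to the valued-field phrasing of the lead's ✓ `Ccurve.dichotomy_of_best_approx`).
* §E `exists_sub_pow_eq_of_form2_general` — the DROP-IN generalisation of ✓ `Ccurve.exists_sub_pow_eq_of_form2`: the hypotheses `hperf`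
  (perfect residues) and `hrep` (`p`-degree `p` of `κ(C)`) are REPLACED by `[Algebra k S] [Algebra.EssFiniteType k S]` (which the lead already builds
  for `S = locAtCentre B′ O`, cf. ✓ `…CcurveRegFinal` l.161–169), and the output gains the disjunct:
  `∃ c U α β i, IsUnit U ∧ w − c^p = U z^i + x α + y β ∧ (¬ p ∣ i ∨ ∀ e : S, U − e^p ∉ 𝔪_S)`.
* §F `not_dvd_of_perfect`, `exists_sub_pow_eq_of_form2_of_perfect` — over perfect residues the second disjunct is void: the lead's conclusion
  `p ∤ i` VERBATIM from `hperf` + `[Algebra.EssFiniteType k S]` (so `hrep` can be dropped even in the perfect case; consistency check).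
* §I `locAtCentre_closure_residue_lift`, `residue_lift_trans`, `hres_of_residue_lift` — the `hres` of §G for the lead's point blow-ups IS kernel
  at the level of the construction: every element of `locAtCentre B[t] O` (`B ⊆ O`, `t ⊆ 𝔪_O`) is ≡ mod `𝔪_O` to an element of `locAtCentre B O`
  (one step = ✓ `curveChart_step`'s `R′ = locAtCentre R[t₁/t₂] O`, `v(t₁/t₂) < 1`); compose along the iteration; convert to the `maximalIdeal` form.
* §G `form2_persists` (and §G′ `form2_persists_of_pRadicallyClosed`, the weakest residue hypothesis: `t^p ≡ φ s ⇒ t ≡ φ s′`, implied by residual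
  surjectivity and by separability of `κ(T)/κ(S)`) — the new branch PERSISTS along any ring map `φ : S → T` of local rings which is residually surjective
  (`∀ t, ∃ s, φ s − t ∈ 𝔪_T`): `∀ e′ : T, (φ U + m) − e′^p ∉ 𝔪_T` for every `m ∈ 𝔪_T`.  The lead's `n ≥ i + 1` point blow-ups along `O`
  (`x = z^n x′`, `y = z^n y′`, new r.s.p. `(z, x′, y′)`, SAME residue field, so the structure map is residually surjective) turn
  `w − c^p = U z^i + x α + y β` into `z^i · (U + z^{n−i}(x′ α + y′ β))`; in the branch `p ∣ i = p i′`, rescaling the representative of the `K^p`-line by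
  `(z^{−i′})^p ∈ K^p` gives the UNIT `U + m`, `m ∈ 𝔪`, whose residue is not a `p`-th power: **FORM (2)** of the conclusion at the new centre.  In the
  branch `p ∤ i` the lead's form (1) packaging is unchanged.  Net effect (for the lead to decide): `persistForm2_of` and with it
  `Ccurve.cleanLU3Defect_of_properCoarsening_perfect` lose `[PerfectField k]` (the other (C-curve) bricks carry the binder without using it, per the
  lead's memo), i.e. the COMPOSITE slice of the research residual becomes field-independent modulo F-02.

Inputs: Mathlib; tree ✓ `Literature/AlgebraicGeometry/Resolution/IntegralClosureEssFiniteType.lean` (+ its import `NormalizationOfVarietiesProofs`,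
E. Noether PROVED); the lead's ✓ `…CcurveUnitCase` (valuation bookkeeping), ✓ `…CcurveQuotientDVR` (`S/(t₀,t₁)` is a DVR), ✓ `…CcurvePersistForm2Alg`
(`charP_quotient_of_ne_top`).  No `sorry`, no new axioms, no Literature facts beyond those (F-02 / F-32 are NOT used here).

Sources: O. Zariski – P. Samuel, Commutative Algebra II, Ch. VI §13 (finiteness of integral closure ⇒ no defect); Q. Liu, Algebraic Geometry and
Arithmetic Curves (2002) Prop. 4.1.27 [Liu2002]; The Stacks Project Tag 0307, Tag 032L (N-2 / Japanese) [StacksProject]; F.-V. Kuhlmann,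
«Valuation theoretic and model theoretic aspects of local uniformization» (2000) §3 (defectless ⇔ best approximation heuristics) [Kuhlmann2000];
V. Cossart – O. Piltant, J. Algebra 529 (2019) [CossartPiltant2019] (the sibling whose Prop. 4.8 uses the same EGA IV 7.7.3 finiteness).
-/

noncomputable section

set_option linter.dupNamespace false

open IsLocalRing Polynomial
open IsDiscreteValuationRing hiding maximalIdeal
open Literature.AlgebraicGeometry.Resolution
open Summit.ResolutionOfSingularities.ResolutionOfSingularities.Theorems.RadicialJung.CleanModels.Ccurve

namespace Summit.ResolutionOfSingularities.ResolutionOfSingularities.Cruxes.DescentPerfectToAll.CpSibling.UnitCaseGeneral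

variable (p : ℕ) [hp : Fact p.Prime]

/-! ## §A  The dichotomy at a maximising approximation (no hypothesis on the residue field) -/

section DVR

variable {D : Type} [CommRing D] [IsDomain D] [IsDiscreteValuationRing D]

/-- `v(z^n) = n` for a uniformizer `z`. [folklore] -/
theorem addVal_uniformizer_pow {z : D} (hz : Irreducible z) (n : ℕ) : addVal D (z ^ n) = n := by
  rw [addVal_pow, addVal_uniformizer hz, nsmul_one]

/-- `z^n ∣ a ↔ n ≤ v(a)`. [folklore] -/
theorem pow_dvd_iff_le_addVal {z : D} (hz : Irreducible z) (n : ℕ) (a : D) : z ^ n ∣ a ↔ (n : ℕ∞) ≤ addVal D a := by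
  rw [← addVal_le_iff_dvd, addVal_uniformizer_pow hz]

/-- **§A — dichotomy core.**  In a DVR `D` of characteristic `p` with uniformizer `z`: if `v(w − c^p)` is bounded as `c` ranges over `D`, then for
some `c` maximising it, `w − c^p = u · z^i` with `u` a unit and EITHER `p ∤ i` OR `u` is not congruent to a `p`-th power modulo `𝔪_D`
(if `p ∣ i` and `u ≡ e^p`, then `c + e z^{i/p}` does strictly better).  The lead's ✓ `Ccurve.unitCase_core` is the special case of a perfect
residue field, where the second alternative is empty. [folklore] -/
theorem unitCase_core_dichotomy [CharP D p] {z : D} (hz : Irreducible z)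
    (w : D) (M : ℕ) (hbound : ∀ c : D, addVal D (w - c ^ p) ≤ M) :
    ∃ (c : D) (i : ℕ) (u : Dˣ), w - c ^ p = u * z ^ i ∧
      (¬ p ∣ i ∨ ∀ e : D, (u : D) - e ^ p ∉ maximalIdeal D) := by
  classical
  let P : ℕ → Prop := fun n => ∃ c : D, addVal D (w - c ^ p) = n
  have hne : ∀ c : D, w - c ^ p ≠ 0 := by
    intro c h0
    have := hbound c
    rw [h0, addVal_zero, top_le_iff] at this
    exact ENat.coe_ne_top _ this
  have hfin : ∀ c : D, ∃ n : ℕ, addVal D (w - c ^ p) = n ∧ n ≤ M := by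
    intro c
    have hlt : addVal D (w - c ^ p) ≠ ⊤ := by rw [Ne, addVal_eq_top_iff]; exact hne c
    obtain ⟨n, hn⟩ := ENat.ne_top_iff_exists.mp hlt
    refine ⟨n, hn.symm, ?_⟩
    have := hbound c
    rw [← hn] at this
    exact_mod_cast this
  set i := Nat.findGreatest P M with hi
  obtain ⟨n₀, hn₀, hn₀M⟩ := hfin 0
  have hPi : P i := Nat.findGreatest_spec hn₀M ⟨0, hn₀⟩
  obtain ⟨c, hc⟩ := hPi
  obtain ⟨i', u, hu⟩ := eq_unit_mul_pow_irreducible (hne c) hz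
  have hii' : i' = i := by
    have h1 : addVal D (w - c ^ p) = i' := addVal_def _ u hz i' hu
    rw [hc] at h1
    exact_mod_cast h1.symm
  rw [hii'] at hu
  refine ⟨c, i, u, hu, ?_⟩
  by_contra hcon
  push Not at hcon
  obtain ⟨⟨m, hm⟩, e, he⟩ := hcon
  rw [hz.maximalIdeal_eq, Ideal.mem_span_singleton] at he
  obtain ⟨r, hr⟩ := he
  set c' := c + e * z ^ m with hc'
  have hkey : w - c' ^ p = z ^ (i + 1) * r := by
    have hfrob : c' ^ p = c ^ p + e ^ p * z ^ i := by
      rw [hc', add_pow_char c (e * z ^ m), mul_pow, ← pow_mul, mul_comm m p, ← hm]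
    calc w - c' ^ p = (w - c ^ p) - e ^ p * z ^ i := by rw [hfrob]; ring
      _ = (u - e ^ p) * z ^ i := by rw [hu]; ring
      _ = z ^ (i + 1) * r := by rw [hr]; ring
  obtain ⟨n', hn', hn'M⟩ := hfin c'
  have hge : ((i + 1 : ℕ) : ℕ∞) ≤ addVal D (w - c' ^ p) := by
    rw [hkey, addVal_mul, addVal_uniformizer_pow hz]
    simp
  rw [hn'] at hge
  have h1 : i + 1 ≤ n' := by exact_mod_cast hge
  have h2 : n' ≤ i := by rw [hi]; exact Nat.le_findGreatest hn'M ⟨c', hn'⟩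
  omega

/-! ## §B  Boundedness of `v(w − c^p)` from finiteness of the integral closure (N-2) -/

/-- **§B — boundedness from N-2.**  `D` a DVR of characteristic `p` with uniformizer `z`, `F = Frac D ⊆ L` fields, `θ ∈ L` with `θ^p = w ∈ D`,
`w` not a `p`-th power in `D`, and the integral closure `R′` of `D` in `L` a finite `D`-module.  Then `v(w − c^p)` is bounded over `c ∈ D`.
Proof: `Q := R′/(D·1)` is finitely generated and torsion-free (`D` is integrally closed in `F`), hence free over the PID `D`; the class of `θ` is
non-zero and has finite `z`-adic order `n₀` in `Q`; `z^{p n₀} ∣ w − c^p` would put `ξ = (θ − c)/z^{n₀}` (with `ξ^p ∈ D`) in `R′` and make the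
class of `θ` divisible by `z^{n₀}`. [cite: Liu2002, Prop. 4.1.27, p. 122] -/
theorem unitCase_bound_of_moduleFinite [CharP D p] {z : D} (hz : Irreducible z)
    (F L : Type) [Field F] [Algebra D F] [IsFractionRing D F] [Field L] [Algebra D L] [Algebra F L] [IsScalarTower D F L]
    (hfinite : Module.Finite D (integralClosure D L))
    (w : D) (hw : ∀ a : D, w ≠ a ^ p) (θ : L) (hθ : θ ^ p = algebraMap D L w) :
    ∃ M : ℕ, ∀ c : D, addVal D (w - c ^ p) ≤ M := by
  classical
  -- injectivity of the structure maps and characteristic of `L`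
  have hinjF : Function.Injective (algebraMap D F) := IsFractionRing.injective D F
  have hinj : Function.Injective (algebraMap D L) := by
    rw [IsScalarTower.algebraMap_eq D F L]; exact (algebraMap F L).injective.comp hinjF
  haveI : CharP L p := charP_of_injective_algebraMap hinj p
  set R' : Subalgebra D L := integralClosure D L with hR'
  haveI : Module.Finite D R' := hfinite
  -- `θ ∈ R'`
  have hθint : IsIntegral D θ := IsIntegral.of_pow hp.out.pos (by rw [hθ]; exact isIntegral_algebraMap)
  set θ' : R' := ⟨θ, (mem_integralClosure_iff D L).mpr hθint⟩ with hθ'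
  -- the submodule `D · 1` and the quotient `Q`
  set N : Submodule D R' := Submodule.span D {(1 : R')} with hN
  have hmemN : ∀ r : R', r ∈ N ↔ ∃ a : D, algebraMap D L a = (r : L) := by
    intro r
    rw [hN, Submodule.mem_span_singleton]
    constructor
    · rintro ⟨a, ha⟩
      refine ⟨a, ?_⟩
      have := congrArg (fun s : R' => (s : L)) ha
      simpa [Algebra.smul_def, eq_comm] using this
    · rintro ⟨a, ha⟩
      refine ⟨a, Subtype.ext ?_⟩
      simp [Algebra.smul_def, ha]
  -- torsion-freeness of `Q = R' ⧸ N`: `D` is integrally closed in `F`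
  haveI : NoZeroSMulDivisors D (R' ⧸ N) := by
    refine ⟨fun {d q} hdq => ?_⟩
    by_cases hd : d = 0
    · exact Or.inl hd
    right
    induction q using Submodule.Quotient.induction_on with
    | H r =>
      rw [Submodule.Quotient.mk_eq_zero]
      rw [← Submodule.Quotient.mk_smul, Submodule.Quotient.mk_eq_zero, hmemN] at hdq
      obtain ⟨a, ha⟩ := hdq
      -- `r = a / d` in `L`, an element of `F` integral over `D`
      have hdr : algebraMap D L d * (r : L) = algebraMap D L a := by
        rw [ha, Subalgebra.coe_smul, Algebra.smul_def]
      have hdL : algebraMap D L d ≠ 0 := (map_ne_zero_iff _ hinj).mpr hd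
      set q₀ : F := algebraMap D F a / algebraMap D F d with hq₀
      have hq₀L : algebraMap F L q₀ = (r : L) := by
        rw [hq₀, map_div₀, ← IsScalarTower.algebraMap_apply, ← IsScalarTower.algebraMap_apply, ← hdr, mul_div_cancel_left₀ _ hdL]
      have hrint : IsIntegral D (r : L) := (mem_integralClosure_iff D L).mp r.2
      have hq₀int : IsIntegral D q₀ := by
        rw [← hq₀L] at hrint
        exact (isIntegral_algHom_iff (IsScalarTower.toAlgHom D F L) (algebraMap F L).injective).mp hrint
      obtain ⟨y, hy⟩ := (IsIntegrallyClosed.isIntegral_iff (R := D) (K := F)).mp hq₀int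
      rw [hmemN]
      exact ⟨y, by rw [← hq₀L, ← hy, ← IsScalarTower.algebraMap_apply]⟩
  haveI : Module.Free D (R' ⧸ N) := Module.free_of_finite_type_torsion_free'
  -- the class `v` of `θ` and a non-zero coordinate
  set b := Module.Free.chooseBasis D (R' ⧸ N) with hb
  set v : R' ⧸ N := N.mkQ θ' with hv
  have hv0 : v ≠ 0 := by
    intro h0
    rw [hv, Submodule.mkQ_apply, Submodule.Quotient.mk_eq_zero, hmemN] at h0
    obtain ⟨a, ha⟩ := h0
    apply hw a
    apply hinj
    rw [map_pow, ha, hθ', hθ]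
  obtain ⟨j, hj⟩ : ∃ j, b.repr v j ≠ 0 := by
    by_contra hall
    push Not at hall
    apply hv0
    have : b.repr v = 0 := Finsupp.ext fun j => by simpa using hall j
    exact (LinearEquiv.map_eq_zero_iff b.repr).mp this
  -- finite `z`-adic order `n₀` of `v`
  set a₀ := b.repr v j with ha₀
  have ha₀top : addVal D a₀ ≠ ⊤ := by rw [Ne, addVal_eq_top_iff]; exact hj
  obtain ⟨m, hm⟩ := ENat.ne_top_iff_exists.mp ha₀top
  set n₀ := m + 1 with hn₀
  have hndvd : ¬ z ^ n₀ ∣ a₀ := by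
    rw [pow_dvd_iff_le_addVal hz, ← hm, hn₀]
    exact_mod_cast Nat.not_succ_le_self m
  have hndiv : ∀ q : R' ⧸ N, v ≠ z ^ n₀ • q := by
    intro q hq
    apply hndvd
    refine ⟨b.repr q j, ?_⟩
    have := congrArg (fun f => b.repr f j) hq
    simpa [map_smul, Finsupp.smul_apply, smul_eq_mul] using this
  -- the bound `M := p * n₀`
  refine ⟨p * n₀, fun c => ?_⟩
  by_contra hlt
  have hle : ((p * n₀ : ℕ) : ℕ∞) ≤ addVal D (w - c ^ p) := le_of_lt (not_le.mp hlt)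
  rw [← pow_dvd_iff_le_addVal hz] at hle
  obtain ⟨r, hr⟩ := hle
  -- `ξ := (θ - c) / z^{n₀}` satisfies `ξ^p = r`
  have hzL : algebraMap D L z ≠ 0 := (map_ne_zero_iff _ hinj).mpr hz.ne_zero
  set ξ : L := (θ - algebraMap D L c) / algebraMap D L z ^ n₀ with hξ
  have hξp : ξ ^ p = algebraMap D L r := by
    rw [hξ, div_pow, sub_pow_char, hθ, ← map_pow, ← map_sub, hr, map_mul, map_pow, ← pow_mul, mul_comm n₀ p,
      mul_div_cancel_left₀ _ (pow_ne_zero _ hzL)]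
  have hξint : IsIntegral D ξ := IsIntegral.of_pow hp.out.pos (by rw [hξp]; exact isIntegral_algebraMap)
  set ξ' : R' := ⟨ξ, (mem_integralClosure_iff D L).mpr hξint⟩ with hξ'
  -- `θ' - c • 1 = z^{n₀} • ξ'` in `R'`
  have hdecomp : θ' - c • (1 : R') = z ^ n₀ • ξ' := by
    apply Subtype.ext
    change θ - ((c • (1 : R') : R') : L) = ((z ^ n₀ • ξ' : R') : L)
    rw [Subalgebra.coe_smul, Subalgebra.coe_smul, Algebra.smul_def, Algebra.smul_def, Subalgebra.coe_one, mul_one, map_pow]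
    change θ - algebraMap D L c = algebraMap D L z ^ n₀ * ξ
    rw [hξ, mul_div_cancel₀ _ (pow_ne_zero _ hzL)]
  have hcN : c • (1 : R') ∈ N := by rw [hN]; exact Submodule.smul_mem _ c (Submodule.mem_span_singleton_self _)
  apply hndiv (N.mkQ ξ')
  calc v = N.mkQ θ' := hv
    _ = N.mkQ (θ' - c • (1 : R')) := by
        rw [map_sub, (Submodule.Quotient.mk_eq_zero N).mpr hcN |> fun h => show N.mkQ (c • (1 : R')) = 0 from h, sub_zero]
    _ = N.mkQ (z ^ n₀ • ξ') := by rw [hdecomp]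
    _ = z ^ n₀ • N.mkQ ξ' := map_smul _ _ _


omit hp in
/-- **§F — consistency with the perfect case.**  If every element of `D` is a `p`-th power modulo `𝔪_D`, the second alternative of
`unitCase_core_dichotomy` is empty. [folklore] -/
theorem not_dvd_of_perfect (hperf : ∀ u : D, ∃ e : D, u - e ^ p ∈ maximalIdeal D) {i : ℕ} {u : D}
    (h : ¬ p ∣ i ∨ ∀ e : D, u - e ^ p ∉ maximalIdeal D) : ¬ p ∣ i := by
  rcases h with h | h
  · exact h
  · obtain ⟨e, he⟩ := hperf u
    exact absurd he (h e)

end DVR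

/-! ## §G  Persistence of «unit whose residue is not a `p`-th power» along residually surjective maps -/

/-- **§G — form (2) persists.**  Let `φ : S → T` be a ring map of local rings which is residually surjective (`∀ t, ∃ s, φ s − t ∈ 𝔪_T`), `T` of
characteristic `p`.  If `U − e^p ∉ 𝔪_S` for every `e ∈ S`, then for every `m ∈ 𝔪_T` and every `e′ ∈ T`, `(φ U + m) − e′^p ∉ 𝔪_T`.
(Pick `e` with `φ e ≡ e′`; then `φ(U − e^p) ≡ φ U + m − e′^p (mod 𝔪_T)`, and `φ(U − e^p)` is a unit.)  Used with the structure map of the lead's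
point blow-ups along `O`, which keep the residue field of the closed centre. [folklore] -/
theorem form2_persists {S T : Type} [CommRing S] [IsLocalRing S] [CommRing T] [IsLocalRing T] [CharP T p]
    (φ : S →+* T) (hres : ∀ t : T, ∃ s : S, φ s - t ∈ maximalIdeal T)
    (U : S) (hU : ∀ e : S, U - e ^ p ∉ maximalIdeal S) (m : T) (hm : m ∈ maximalIdeal T) :
    ∀ e' : T, (φ U + m) - e' ^ p ∉ maximalIdeal T := by
  intro e' h
  obtain ⟨e, he⟩ := hres e'
  have hunit : IsUnit (U - e ^ p) := by
    by_contra hnu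
    exact hU e ((mem_maximalIdeal _).mpr hnu)
  have hφunit : IsUnit (φ (U - e ^ p)) := hunit.map φ
  apply (mem_maximalIdeal _).mp _ hφunit
  have hpow : (φ e - e') ^ p ∈ maximalIdeal T := Ideal.pow_mem_of_mem _ he p hp.out.pos
  have hid : φ (U - e ^ p) = ((φ U + m) - e' ^ p) - m - (φ e - e') ^ p := by
    rw [sub_pow_char (φ e) e', map_sub, map_pow]; ring
  rw [hid]
  exact Ideal.sub_mem _ (Ideal.sub_mem _ h hm) hpow

/-- **§G′ — form (2) persists under the WEAKEST residue hypothesis**: it suffices that the image residue field be `p`-radically closed in `κ(T)`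
(`hrad`: if `t^p` is congruent to an element of `φ(S)` modulo `𝔪_T`, then so is `t`) — implied by residual surjectivity (§G) and by separability of
`κ(T)/κ(S)`.  Then `U − e^p ∉ 𝔪_S` for all `e` gives `(φ U + m) − e′^p ∉ 𝔪_T` for all `e′ ∈ T`, `m ∈ 𝔪_T`. [folklore] -/
theorem form2_persists_of_pRadicallyClosed {S T : Type} [CommRing S] [IsLocalRing S] [CommRing T] [IsLocalRing T] [CharP T p]
    (φ : S →+* T) (hrad : ∀ t : T, (∃ s : S, φ s - t ^ p ∈ maximalIdeal T) → ∃ s : S, φ s - t ∈ maximalIdeal T)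
    (U : S) (hU : ∀ e : S, U - e ^ p ∉ maximalIdeal S) (m : T) (hm : m ∈ maximalIdeal T) :
    ∀ e' : T, (φ U + m) - e' ^ p ∉ maximalIdeal T := by
  intro e' h
  have hUe' : φ U - e' ^ p ∈ maximalIdeal T := by
    have hid : φ U - e' ^ p = ((φ U + m) - e' ^ p) - m := by ring
    rw [hid]
    exact Ideal.sub_mem _ h hm
  obtain ⟨e, he⟩ := hrad e' ⟨U, hUe'⟩
  have hunit : IsUnit (U - e ^ p) := by
    by_contra hnu
    exact hU e ((mem_maximalIdeal _).mpr hnu)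
  have hφunit : IsUnit (φ (U - e ^ p)) := hunit.map φ
  apply (mem_maximalIdeal _).mp _ hφunit
  have hpow : (φ e - e') ^ p ∈ maximalIdeal T := Ideal.pow_mem_of_mem _ he p hp.out.pos
  have hid : φ (U - e ^ p) = (φ U - e' ^ p) - (φ e - e') ^ p := by
    rw [sub_pow_char (φ e) e', map_sub, map_pow]; ring
  rw [hid]
  exact Ideal.sub_mem _ hUe' hpow

/-! ## §I  Residual surjectivity of local blow-ups whose new generators lie in `𝔪_O` (the `hres` of §G for the lead's point blow-ups) -/

section ResidualSurjectivity

variable {K : Type} [Field K]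

/-- Every element of `B[t]` (`t ⊆ 𝔪_O`, `B ⊆ O`) has value `≤ 1` and is congruent modulo `𝔪_O` to an element of `B`. [folklore] -/
theorem exists_mem_valuation_sub_lt_one_of_mem_closure (O : ValuationSubring K) (B : Subring K) (hB : B ≤ O.toSubring)
    (t : Set K) (ht : ∀ x ∈ t, O.valuation x < 1) :
    ∀ y ∈ Subring.closure ((B : Set K) ∪ t), O.valuation y ≤ 1 ∧ ∃ y₀ ∈ B, O.valuation (y - y₀) < 1 := by
  intro y hy
  induction hy using Subring.closure_induction with
  | mem x hx =>
    rcases hx with hx | hx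
    · exact ⟨(O.valuation_le_one_iff x).mpr (hB hx), x, hx, by simp⟩
    · exact ⟨le_of_lt (ht x hx), 0, B.zero_mem, by simpa using ht x hx⟩
  | zero => exact ⟨by simp, 0, B.zero_mem, by simp⟩
  | one => exact ⟨by simp, 1, B.one_mem, by simp⟩
  | add x y _ _ hx hy =>
    obtain ⟨hx1, x₀, hx₀, hxlt⟩ := hx
    obtain ⟨hy1, y₀, hy₀, hylt⟩ := hy
    refine ⟨(Valuation.map_add _ _ _).trans (max_le hx1 hy1), x₀ + y₀, B.add_mem hx₀ hy₀, ?_⟩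
    have hid : x + y - (x₀ + y₀) = (x - x₀) + (y - y₀) := by ring
    rw [hid]
    exact Valuation.map_add_lt _ hxlt hylt
  | neg x _ hx =>
    obtain ⟨hx1, x₀, hx₀, hxlt⟩ := hx
    refine ⟨by rwa [Valuation.map_neg], -x₀, B.neg_mem hx₀, ?_⟩
    have hid : -x - -x₀ = -(x - x₀) := by ring
    rw [hid, Valuation.map_neg]
    exact hxlt
  | mul x y _ _ hx hy =>
    obtain ⟨hx1, x₀, hx₀, hxlt⟩ := hx
    obtain ⟨hy1, y₀, hy₀, hylt⟩ := hy
    have hx₀1 : O.valuation x₀ ≤ 1 := (O.valuation_le_one_iff x₀).mpr (hB hx₀)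
    refine ⟨by rw [map_mul]; exact mul_le_one' hx1 hy1, x₀ * y₀, B.mul_mem hx₀ hy₀, ?_⟩
    have hid : x * y - x₀ * y₀ = (x - x₀) * y + x₀ * (y - y₀) := by ring
    rw [hid]
    refine Valuation.map_add_lt _ ?_ ?_
    · rw [map_mul]
      calc O.valuation (x - x₀) * O.valuation y ≤ O.valuation (x - x₀) * 1 := mul_le_mul' le_rfl hy1
        _ < 1 := by rw [mul_one]; exact hxlt
    · rw [map_mul]
      calc O.valuation x₀ * O.valuation (y - y₀) ≤ 1 * O.valuation (y - y₀) := mul_le_mul' hx₀1 le_rfl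
        _ < 1 := by rw [one_mul]; exact hylt

/-- **§I — residual surjectivity of a local blow-up with exceptional generators in `𝔪_O`** (valuation form): for `B ⊆ O` and `t ⊆ 𝔪_O`, every
element of `locAtCentre B[t] O` is congruent modulo `𝔪_O` to an element of `locAtCentre B O`.  (With `t = {t₁/t₂}`, `v(t₁) < v(t₂)`, this is the
one-step lemma ✓ `curveChart_step`; iterate with `residue_lift_trans`.)  [cite: NovacoskiSpivakovsky2014, Def. 2.8] -/
theorem locAtCentre_closure_residue_lift (O : ValuationSubring K) (B : Subring K) (hB : B ≤ O.toSubring)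
    (t : Set K) (ht : ∀ x ∈ t, O.valuation x < 1) :
    ∀ r ∈ locAtCentre (Subring.closure ((B : Set K) ∪ t)) O, ∃ s ∈ locAtCentre B O, O.valuation (r - s) < 1 := by
  rintro _ ⟨y, hy, z, hz, hvz, rfl⟩
  obtain ⟨-, y₀, hy₀, hylt⟩ := exists_mem_valuation_sub_lt_one_of_mem_closure O B hB t ht y hy
  obtain ⟨-, z₀, hz₀, hzlt⟩ := exists_mem_valuation_sub_lt_one_of_mem_closure O B hB t ht z hz
  have hvz₀ : O.valuation z₀ = 1 := by
    have hid : z₀ = z + -(z - z₀) := by ring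
    rw [hid, Valuation.map_add_eq_of_lt_left]
    · exact hvz
    · rw [Valuation.map_neg, hvz]; exact hzlt
  have hz0 := ne_zero_of_valuation_eq_one hvz
  have hz₀0 := ne_zero_of_valuation_eq_one hvz₀
  refine ⟨y₀ / z₀, ⟨y₀, hy₀, z₀, hz₀, hvz₀, rfl⟩, ?_⟩
  have hid : y / z - y₀ / z₀ = ((y - y₀) * z₀ + y₀ * (z₀ - z)) / (z * z₀) := by
    field_simp
    ring
  rw [hid, map_div₀, map_mul, hvz, hvz₀, mul_one, div_one]
  refine Valuation.map_add_lt _ ?_ ?_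
  · rw [map_mul, hvz₀, mul_one]; exact hylt
  · have hy₀1 : O.valuation y₀ ≤ 1 := (O.valuation_le_one_iff y₀).mpr (hB hy₀)
    rw [map_mul]
    calc O.valuation y₀ * O.valuation (z₀ - z) ≤ 1 * O.valuation (z₀ - z) := mul_le_mul' hy₀1 le_rfl
      _ < 1 := by rw [one_mul, ← Valuation.map_neg, neg_sub]; exact hzlt

/-- **The one-step instance matching ✓ `curveChart_step`**: for `R ⊆ O` and `t₁, t₂ ∈ K` with `v(t₁) < v(t₂)`, every element of
`R′ = locAtCentre R[t₁/t₂] O` is ≡ mod `𝔪_O` to an element of `locAtCentre R O` (`= R` when `R` is itself a `locAtCentre`, Literature ✓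
`locAtCentre_locAtCentre`). [folklore] -/
theorem curveChart_residue_lift (O : ValuationSubring K) (R : Subring K) (hRO : R ≤ O.toSubring) (t₁ t₂ : K)
    (hv : O.valuation t₁ < O.valuation t₂) :
    ∀ r ∈ locAtCentre (Subring.closure ((R : Set K) ∪ {t₁ / t₂})) O, ∃ s ∈ locAtCentre R O, O.valuation (r - s) < 1 := by
  refine locAtCentre_closure_residue_lift O R hRO {t₁ / t₂} fun x hx => ?_
  rw [Set.mem_singleton_iff] at hx
  subst hx
  have ht₂ : O.valuation t₂ ≠ 0 := ne_of_gt (lt_of_le_of_lt zero_le hv)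
  rw [map_div₀, div_lt_one₀ (zero_lt_iff.mpr ht₂)]
  exact hv

/-- The same with `R = locAtCentre A O` (the shape of `R₂` inside ✓ `exists_model_rsop_div_pow`): the lift lands in `R` itself. [folklore] -/
theorem curveChart_residue_lift' (O : ValuationSubring K) (A : Subring K) (hAO : A ≤ O.toSubring) (t₁ t₂ : K)
    (hv : O.valuation t₁ < O.valuation t₂) :
    ∀ r ∈ locAtCentre (Subring.closure ((locAtCentre A O : Set K) ∪ {t₁ / t₂})) O,
      ∃ s ∈ locAtCentre A O, O.valuation (r - s) < 1 := by
  intro r hr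
  obtain ⟨s, hs, hlt⟩ := curveChart_residue_lift O (locAtCentre A O) (locAtCentre_le hAO) t₁ t₂ hv r hr
  rw [locAtCentre_locAtCentre] at hs
  exact ⟨s, hs, hlt⟩

/-- Residue lifting composes along a tower `S₁ ⊆ S₂ ⊆ S₃ ⊆ O` (valuation form; no hypotheses on the sets). [folklore] -/
theorem residue_lift_trans (O : ValuationSubring K) {S₁ S₂ S₃ : Set K}
    (h₁₂ : ∀ r ∈ S₂, ∃ s ∈ S₁, O.valuation (r - s) < 1) (h₂₃ : ∀ r ∈ S₃, ∃ s ∈ S₂, O.valuation (r - s) < 1) :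
    ∀ r ∈ S₃, ∃ s ∈ S₁, O.valuation (r - s) < 1 := by
  intro r hr
  obtain ⟨s₂, hs₂, h₂⟩ := h₂₃ r hr
  obtain ⟨s₁, hs₁, h₁⟩ := h₁₂ s₂ hs₂
  refine ⟨s₁, hs₁, ?_⟩
  have hid : r - s₁ = (r - s₂) + (s₂ - s₁) := by ring
  rw [hid]
  exact Valuation.map_add_lt _ h₂ h₁

/-- **From the valuation form to the `hres` of §G** for an inclusion of local rings `S ⊆ locAtCentre B″ O` dominated by `O`. [folklore] -/
theorem hres_of_residue_lift (O : ValuationSubring K) {S : Subring K} {B'' : Subring K} (hB''O : B'' ≤ O.toSubring)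
    (hle : S ≤ locAtCentre B'' O)
    (hlift : ∀ r ∈ locAtCentre B'' O, ∃ s ∈ S, O.valuation (r - s) < 1) :
    haveI := isLocalRing_locAtCentre hB''O
    ∀ r : locAtCentre B'' O, ∃ s : S, Subring.inclusion hle s - r ∈ maximalIdeal (locAtCentre B'' O) := by
  haveI := isLocalRing_locAtCentre hB''O
  intro r
  obtain ⟨s, hs, hlt⟩ := hlift r r.2
  refine ⟨⟨s, hs⟩, ?_⟩
  rw [mem_maximalIdeal_locAtCentre_iff hB''O]
  change O.valuation (s - (r : K)) < 1
  rw [← Valuation.map_neg, neg_sub]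
  exact hlt

end ResidualSurjectivity

/-! ## §C  N-2 for domains essentially of finite type over a field -/

/-- **§C — Japanese-ness (N-2) of domains essentially of finite type over a field, in a finite extension of the fraction field**: the integral
closure of `D` in a finite extension `L` of `Frac D` is a finite `D`-module.  (E. Noether for the finite-type subalgebra `A₀` with `D = M⁻¹A₀`, tree ✓
`NoetherFiniteIntegralClosure_holds`; then localisation, tree ✓ `module_finite_integralClosure_of_isLocalization`.)
[cite: Liu2002, Prop. 4.1.27, p. 122] [cite: StacksProject, Tag 0307] -/
theorem moduleFinite_integralClosure_of_essFiniteType (k : Type) [Field k] (D F L : Type) [CommRing D] [IsDomain D]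
    [Algebra k D] [Algebra.EssFiniteType k D] [Field F] [Algebra D F] [IsFractionRing D F]
    [Field L] [Algebra D L] [Algebra F L] [IsScalarTower D F L] [FiniteDimensional F L] :
    Module.Finite D (integralClosure D L) := by
  set A₀ := Algebra.EssFiniteType.subalgebra k D
  haveI : IsScalarTower A₀ D L := IsScalarTower.of_algebraMap_eq fun _ => rfl
  haveI : IsScalarTower A₀ D F := IsScalarTower.of_algebraMap_eq fun _ => rfl
  haveI : IsFractionRing A₀ F := isFractionRing_subalgebra_of_isLocalization k D F
  haveI : IsScalarTower A₀ F L := IsScalarTower.of_algebraMap_eq fun x => by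
    change algebraMap D L (x : D) = algebraMap F L (algebraMap D F (x : D))
    exact IsScalarTower.algebraMap_apply D F L (x : D)
  have h₀ : Module.Finite A₀ (integralClosure A₀ L) := NoetherFiniteIntegralClosure_holds k A₀ F L
  exact module_finite_integralClosure_of_isLocalization (Algebra.EssFiniteType.submonoid k D) h₀

/-! ## §D  The general unit case in a DVR essentially of finite type over a field -/

section DVRMain

variable {D : Type} [CommRing D] [IsDomain D] [IsDiscreteValuationRing D]

omit hp in
/-- Not a `p`-th power in `D` after clearing denominators ⇒ not a `p`-th power in `Frac D`. [folklore] -/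
theorem not_pow_fractionRing (F : Type) [Field F] [Algebra D F] [IsFractionRing D F]
    (w : D) (hw : ∀ a b : D, b ≠ 0 → b ^ p * w ≠ a ^ p) : ∀ b : F, b ^ p ≠ algebraMap D F w := by
  intro b hb
  obtain ⟨a, d, hd, rfl⟩ := IsFractionRing.div_surjective (A := D) b
  have hd0 : d ≠ 0 := nonZeroDivisors.ne_zero hd
  have hdF : algebraMap D F d ≠ 0 := (map_ne_zero_iff _ (IsFractionRing.injective D F)).mpr hd0
  apply hw a d hd0
  apply IsFractionRing.injective D F
  rw [map_mul, map_pow, map_pow, ← hb, div_pow, mul_div_cancel₀ _ (pow_ne_zero _ hdF)]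

/-- **§D — the general unit case.**  `D` a discrete valuation ring of characteristic `p`, essentially of finite type over a field `k`, with
uniformizer `z`; `w ∈ D` not a `p`-th power in `Frac D` (`b^p w ≠ a^p` whenever `b ≠ 0`).  Then for some `c ∈ D`, `w − c^p = u · z^i` with `u` a unit
and `p ∤ i` OR `u − e^p ∉ 𝔪_D` for every `e ∈ D`.  (§C: `D` is N-2; §B with `L := Frac(D)[X]/(X^p − w)`, a field since `X^p − w` is irreducible,
Mathlib `X_pow_sub_C_irreducible_of_prime`; §A.)  The lead's ✓ `Ccurve.exists_sub_pow_eq_unit_mul_pow` (perfect residue field, `p`-degree `p`)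
is the special case in which the second alternative is empty and boundedness comes from the `p`-basis `z̄`.
[cite: Liu2002, Prop. 4.1.27, p. 122] [cite: StacksProject, Tag 0307] -/
theorem exists_sub_pow_eq_unit_mul_pow_general [CharP D p] (k : Type) [Field k] [Algebra k D] [Algebra.EssFiniteType k D]
    {z : D} (hz : Irreducible z) (w : D) (hw : ∀ a b : D, b ≠ 0 → b ^ p * w ≠ a ^ p) :
    ∃ (c : D) (i : ℕ) (u : Dˣ), w - c ^ p = u * z ^ i ∧
      (¬ p ∣ i ∨ ∀ e : D, (u : D) - e ^ p ∉ maximalIdeal D) := by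
  classical
  let F := FractionRing D
  have hwF : ∀ b : F, b ^ p ≠ algebraMap D F w := not_pow_fractionRing p F w hw
  let f : F[X] := X ^ p - C (algebraMap D F w)
  have hfirr : Irreducible f := X_pow_sub_C_irreducible_of_prime hp.out hwF
  haveI : Fact (Irreducible f) := ⟨hfirr⟩
  let L := AdjoinRoot f
  haveI : Module.Finite F L := (AdjoinRoot.powerBasis hfirr.ne_zero).finite
  have hθ : (AdjoinRoot.root f) ^ p = algebraMap D L w := by
    have h := AdjoinRoot.eval₂_root f
    simp only [f, eval₂_sub, eval₂_X_pow, eval₂_C] at h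
    rw [sub_eq_zero] at h
    rw [h, IsScalarTower.algebraMap_apply D F L, AdjoinRoot.algebraMap_eq]
  have hfin : Module.Finite D (integralClosure D L) := moduleFinite_integralClosure_of_essFiniteType k D F L
  obtain ⟨M, hM⟩ := unitCase_bound_of_moduleFinite p hz F L hfin w
    (fun a h => hw a 1 one_ne_zero (by rw [one_pow, one_mul]; exact h)) (AdjoinRoot.root f) hθ
  exact unitCase_core_dichotomy p hz w M hM

/-- **§D′ — boundedness alone** (for consumers who prefer the valued-field phrasing, e.g. the lead's ✓ `Ccurve.dichotomy_of_best_approx`): `D` a DVR of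
characteristic `p` essentially of finite type over a field, `w` not a `p`-th power in `Frac D` ⇒ `v(w − c^p)` is bounded on `D`. [cite: Liu2002, Prop. 4.1.27, p. 122] -/
theorem unitCase_bound_general [CharP D p] (k : Type) [Field k] [Algebra k D] [Algebra.EssFiniteType k D]
    {z : D} (hz : Irreducible z) (w : D) (hw : ∀ a b : D, b ≠ 0 → b ^ p * w ≠ a ^ p) :
    ∃ M : ℕ, ∀ c : D, addVal D (w - c ^ p) ≤ M := by
  classical
  let F := FractionRing D
  have hwF : ∀ b : F, b ^ p ≠ algebraMap D F w := not_pow_fractionRing p F w hw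
  let f : F[X] := X ^ p - C (algebraMap D F w)
  have hfirr : Irreducible f := X_pow_sub_C_irreducible_of_prime hp.out hwF
  haveI : Fact (Irreducible f) := ⟨hfirr⟩
  let L := AdjoinRoot f
  haveI : Module.Finite F L := (AdjoinRoot.powerBasis hfirr.ne_zero).finite
  have hθ : (AdjoinRoot.root f) ^ p = algebraMap D L w := by
    have h := AdjoinRoot.eval₂_root f
    simp only [f, eval₂_sub, eval₂_X_pow, eval₂_C] at h
    rw [sub_eq_zero] at h
    rw [h, IsScalarTower.algebraMap_apply D F L, AdjoinRoot.algebraMap_eq]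
  have hfin : Module.Finite D (integralClosure D L) := moduleFinite_integralClosure_of_essFiniteType k D F L
  exact unitCase_bound_of_moduleFinite p hz F L hfin w
    (fun a h => hw a 1 one_ne_zero (by rw [one_pow, one_mul]; exact h)) (AdjoinRoot.root f) hθ

/-- **§H — a BEST `p`-th-power approximation exists in `D`** (the «defectless ⇒ best approximation» statement of the class-(A) engine, here for the
degree-`p` radical extension of an N-2 DVR; no `IsDefectlessField` hypothesis needed): `∃ c₀, ∀ c, v(w − c^p) ≤ v(w − c₀^p)`.
[cite: Kuhlmann2000, §3] -/
theorem exists_best_pthPowerApprox [CharP D p] (k : Type) [Field k] [Algebra k D] [Algebra.EssFiniteType k D]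
    {z : D} (hz : Irreducible z) (w : D) (hw : ∀ a b : D, b ≠ 0 → b ^ p * w ≠ a ^ p) :
    ∃ c₀ : D, ∀ c : D, addVal D (w - c ^ p) ≤ addVal D (w - c₀ ^ p) := by
  classical
  obtain ⟨M, hbound⟩ := unitCase_bound_general p k hz w hw
  let P : ℕ → Prop := fun n => ∃ c : D, addVal D (w - c ^ p) = n
  have hfin : ∀ c : D, ∃ n : ℕ, addVal D (w - c ^ p) = n ∧ n ≤ M := by
    intro c
    have hlt : addVal D (w - c ^ p) ≠ ⊤ := by
      intro htop
      have := hbound c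
      rw [htop, top_le_iff] at this
      exact ENat.coe_ne_top _ this
    obtain ⟨n, hn⟩ := ENat.ne_top_iff_exists.mp hlt
    refine ⟨n, hn.symm, ?_⟩
    have := hbound c
    rw [← hn] at this
    exact_mod_cast this
  obtain ⟨n₀, hn₀, hn₀M⟩ := hfin 0
  have hP0 : P n₀ := ⟨0, hn₀⟩
  obtain ⟨c₀, hc₀⟩ : P (Nat.findGreatest P M) := Nat.findGreatest_spec hn₀M hP0
  refine ⟨c₀, fun c => ?_⟩
  obtain ⟨n, hn, hnM⟩ := hfin c
  rw [hn, hc₀]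
  have hPn : P n := ⟨c, hn⟩
  exact_mod_cast Nat.le_findGreatest hnM hPn

end DVRMain

/-! ## §E  The S-level drop-in generalisation of `Ccurve.exists_sub_pow_eq_of_form2` -/

/-- **§E — the algebraic step of a field-independent `persistForm2`.**  `S` regular local of characteristic `p`, essentially of finite type over a
field `k`, with r.s.p. `(x, y, z)`; if `w` is not a `p`-th power modulo `P = (x, y)` after clearing denominators prime to `P` (form (2) at `S_P`, the
lead's `hw` VERBATIM), then `w − c^p = U z^i + x α + y β` with `U` a unit and **`p ∤ i` or `U − e^p ∉ 𝔪_S` for all `e ∈ S`**.  Compared with ✓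
`Ccurve.exists_sub_pow_eq_of_form2`: the hypotheses `hperf`, `hrep` are replaced by `[Algebra k S] [Algebra.EssFiniteType k S]`; the conclusion gains
the second alternative (which §G carries through the point blow-ups to FORM (2) upstairs). [folklore] -/
theorem exists_sub_pow_eq_of_form2_general {S : Type} [CommRing S] [IsRegularLocalRing S] [CharP S p]
    (k : Type) [Field k] [Algebra k S] [Algebra.EssFiniteType k S]
    (hd : (maximalIdeal S).spanFinrank = 3) (x y z : S) (hxyz : Ideal.span ({x, y, z} : Set S) = maximalIdeal S)
    (w : S) (hw : ∀ a b : S, b ∉ Ideal.span ({x, y} : Set S) → b ^ p * w - a ^ p ∉ Ideal.span ({x, y} : Set S)) :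
    ∃ (c U α β : S) (i : ℕ), IsUnit U ∧ w - c ^ p = U * z ^ i + x * α + y * β ∧
      (¬ p ∣ i ∨ ∀ e : S, U - e ^ p ∉ maximalIdeal S) := by
  classical
  set P : Ideal S := Ideal.span ({x, y} : Set S) with hP
  let t : Fin 3 → S := ![x, y, z]
  have ht : Ideal.span (Set.range t) = maximalIdeal S := by
    rw [← hxyz]; congr 1; ext a; simp only [t, Set.mem_range, Set.mem_insert_iff, Set.mem_singleton_iff]
    constructor
    · rintro ⟨i, rfl⟩; fin_cases i <;> simp
    · rintro (rfl | rfl | rfl)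
      exacts [⟨0, rfl⟩, ⟨1, rfl⟩, ⟨2, rfl⟩]
  obtain ⟨hdom, hdvr, hz⟩ := quotient_span_pair_dvr hd t ht
  change IsDomain (S ⧸ P) at hdom
  change IsDiscreteValuationRing (S ⧸ P) at hdvr
  change Irreducible (Ideal.Quotient.mk P z) at hz
  haveI := hdom
  haveI := hdvr
  have hPtop : P ≠ ⊤ := Ideal.IsPrime.ne_top ((Ideal.Quotient.isDomain_iff_prime P).mp hdom)
  haveI hcharD : CharP (S ⧸ P) p := charP_quotient_of_ne_top p P hPtop
  haveI : Algebra.EssFiniteType k (S ⧸ P) :=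
    Algebra.EssFiniteType.of_surjective (Ideal.Quotient.mkₐ k P) (Ideal.Quotient.mkₐ_surjective k P)
  -- `w̄` is not a `p`-th power in `Frac (S ⧸ P)`
  have hwD : ∀ a b : S ⧸ P, b ≠ 0 → b ^ p * Ideal.Quotient.mk P w ≠ a ^ p := by
    intro a b hb h
    obtain ⟨a, rfl⟩ := Ideal.Quotient.mk_surjective a
    obtain ⟨b, rfl⟩ := Ideal.Quotient.mk_surjective b
    have hbP : b ∉ P := fun hbP => hb (Ideal.Quotient.eq_zero_iff_mem.mpr hbP)
    apply hw a b hbP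
    rw [← Ideal.Quotient.eq, map_mul, map_pow, map_pow]
    exact h
  obtain ⟨cbar, i, ubar, hc, hdich⟩ := exists_sub_pow_eq_unit_mul_pow_general p k hz (Ideal.Quotient.mk P w) hwD
  -- lift to `S`
  obtain ⟨c, rfl⟩ := Ideal.Quotient.mk_surjective cbar
  obtain ⟨U, hU⟩ := Ideal.Quotient.mk_surjective (ubar : S ⧸ P)
  haveI : IsLocalHom (Ideal.Quotient.mk P) := IsLocalHom.of_surjective _ Ideal.Quotient.mk_surjective
  have hUunit : IsUnit U := isUnit_of_map_unit (Ideal.Quotient.mk P) U (by rw [hU]; exact ubar.isUnit)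
  have hmem : w - c ^ p - U * z ^ i ∈ P := by
    rw [← Ideal.Quotient.eq, map_sub, map_pow, hc, map_mul, map_pow, hU]
  obtain ⟨α, β, hαβ⟩ := Ideal.mem_span_pair.mp hmem
  refine ⟨c, U, α, β, i, hUunit, ?_, ?_⟩
  · have h1 : w - c ^ p = U * z ^ i + (w - c ^ p - U * z ^ i) := by ring
    rw [h1, ← hαβ]; ring
  · rcases hdich with hndvd | hres
    · exact Or.inl hndvd
    · refine Or.inr fun e he => hres (Ideal.Quotient.mk P e) ?_
      -- `U - e^p ∈ 𝔪_S` ⇒ its image is a non-unit of `S ⧸ P`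
      rw [← hU, ← map_pow, ← map_sub]
      refine (mem_maximalIdeal _).mpr fun hunit => ?_
      exact (mem_maximalIdeal _).mp he ((isUnit_map_iff (Ideal.Quotient.mk P) _).mp hunit)


/-- **§F′ — the lead's statement recovered (and `hrep` dropped).**  Over a residue field in which every element of `S` is a `p`-th power modulo
`𝔪_S` (`hperf`, e.g. `k` perfect and the centre closed), §E gives EXACTLY the conclusion of ✓ `Ccurve.exists_sub_pow_eq_of_form2`, with the
`p`-degree hypothesis `hrep` replaced by `[Algebra.EssFiniteType k S]`. [folklore] -/
theorem exists_sub_pow_eq_of_form2_of_perfect {S : Type} [CommRing S] [IsRegularLocalRing S] [CharP S p]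
    (k : Type) [Field k] [Algebra k S] [Algebra.EssFiniteType k S]
    (hd : (maximalIdeal S).spanFinrank = 3) (x y z : S) (hxyz : Ideal.span ({x, y, z} : Set S) = maximalIdeal S)
    (hperf : ∀ u : S, ∃ e : S, u - e ^ p ∈ maximalIdeal S)
    (w : S) (hw : ∀ a b : S, b ∉ Ideal.span ({x, y} : Set S) → b ^ p * w - a ^ p ∉ Ideal.span ({x, y} : Set S)) :
    ∃ (c U α β : S) (i : ℕ), IsUnit U ∧ ¬ p ∣ i ∧ w - c ^ p = U * z ^ i + x * α + y * β := by
  obtain ⟨c, U, α, β, i, hU, heq, hdich⟩ := exists_sub_pow_eq_of_form2_general p k hd x y z hxyz w hw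
  refine ⟨c, U, α, β, i, hU, ?_, heq⟩
  rcases hdich with h | h
  · exact h
  · obtain ⟨e, he⟩ := hperf U
    exact absurd he (h e)


end Summit.ResolutionOfSingularities.ResolutionOfSingularities.Cruxes.DescentPerfectToAll.CpSibling.UnitCaseGeneral

end
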